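import Literature.Claims.NS.Betts2026
import Literature.Claims.NS.ClayPeriodicBlowupAlternative
import Literature.Claims.NS.ClayHorizonBridge
import Literature.Claims.NS.ClayPeriodicPressureBridge
import Literature.Analysis.FluidPDE.TorusNSBealeKatoMajda
import Literature.Analysis.FluidPDE.ExtremeGrowthVorticityControl
import Literature.Analysis.FluidPDE.DuchonRobertInviscidLimit
import Literature.Analysis.FunctionSpaces.TorusSupNormContinuity
import HarnessLib

/-!
# Solo salvage for claim C153 `Betts2026` (cell `ns-claims`, D-0090): the integral-form periodic
# Beale–Kato–Majda step is TRUE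

Claim C153: skeleton `Literature.Claims.NS.Betts2026` (typist-6 g5). Its `Step_Thm61_BKM` (Thm 6.1 (87)
p.15 + §9 assembly) reads: if EVERY periodic classical solution on EVERY half-open slab `[0,T)` from the
datum has `∫₀ᵀ ‖∇u(t)‖_∞ dt < ∞` (lower integral of `⨆ₓ ‖∇u(t,x)‖ₑ`), then the datum launches a global smooth
periodic solution (`clayPeriodicErrata.Solvable ν 0 u₀`). Classical (BKM continuation + periodic local
existence); typist's flag: «TRUE-type, not in the tree in this integral form».

`step_Thm61_BKM_holds : Step_Thm61_BKM` — PROVED here from tree theorems: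
* the periodic blow-up alternative `ClayVariants.clayPeriodic_solvable_or_gradientSupBlowup` (RRS Lemma 6.11 /
  Thm 6.8): either `(ν, 0, u₀)` is solvable, or there is a periodic classical solution on a slab `[0,T*)`
  whose ENSTROPHY per period cell `Torus.gradNormSq` is unbounded;
* the torus enstrophy bound under a continuous vorticity majorant
  `Torus.gradNormSq_le_mul_exp_integral_vorticityBound` (`∫|∇u(t)|² ≤ ∫|∇u(0)|²·exp(2∫₀ᵗ M)`);
* the majorant `M(t) = √6 · sup_x ‖∇u(t,x)‖`, continuous in `t` by `Torus.IsSmoothSpaceTimeOn.torusFderiv`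
  + `continuousOn_toReal_eSupNorm`, with `|ω|² ≤ 2Σᵢ‖∂ᵢu‖² ≤ 6‖∇u‖²`
  (`torusVorticitySqAt_le_two_mul_sum_norm_sq`), and `∫₀ᵗ M ≤ √6·(∫⁻_{(0,T*)} ⨆‖∇u‖ₑ).toReal < ∞` by the
  hypothesis — so the enstrophy is bounded on `[0,T*)`, contradiction; printed ↔ errata solvability by
  `clayPeriodic_solvable_zero_iff_errata`.

Salvage seat `ns-claims-salvage-p1` g3 (solo lane; no statement item; the located step of the verdict is
untouched — this is the TRUE column).

WHAT THIS IS NOT: not a claim about NS regularity or blow-up; not a claim about any author beyond the typed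
locator.
-/

set_option linter.dupNamespace false

noncomputable section

open Set Filter MeasureTheory Topology
open scoped ENNReal NNReal

namespace Summit.NavierStokesRegularity.NavierStokesRegularity.Theorems.Betts2026Salvage

open Literature.Analysis.FluidPDE Literature.Analysis.FunctionSpaces
open Literature.Claims.NS.ClayVariants

/-- `sup_x ‖Df(x)‖` over the torus of the torus derivative of a descended periodic slice is bounded by the
`iSup` over `ℝ³` of `‖D(lift)(y)‖ₑ` (every torus point is `proj` of its representative; `Torus.fderiv_lift`).
[folklore] -/
private theorem eSupNorm_torusFderiv_le {U : UnitAddTorus (Fin 3) → EuclideanSpace ℝ (Fin 3)}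
    {v : EuclideanSpace ℝ (Fin 3) → EuclideanSpace ℝ (Fin 3)} (hUv : Torus.lift U = v) :
    eSupNorm (fun x => Torus.fderiv U x) ≤ ⨆ y : EuclideanSpace ℝ (Fin 3), ‖fderiv ℝ v y‖ₑ := by
  refine iSup_le fun x => ?_
  have h : Torus.fderiv U x = fderiv ℝ v (Torus.repr x) := by
    rw [← hUv, Torus.fderiv_lift, Torus.proj_repr]
  show ‖Torus.fderiv U x‖ₑ ≤ _
  rw [h]
  exact le_iSup (fun y : EuclideanSpace ℝ (Fin 3) => ‖fderiv ℝ v y‖ₑ) (Torus.repr x)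

/-- **Step `Step_Thm61_BKM` of C153 holds**: the integral-form periodic Beale–Kato–Majda continuation
(finite `∫₀ᵀ‖∇u‖_∞` on every half-open slab of every periodic classical solution from the datum ⇒ the datum
is (B)-solvable in the errata reading). [cite: Betts2026, Thm 6.1 (87) p.15 l.30–35; §9 p.21–23]
[cite: BealeKatoMajda1984, Thm 1] [cite: RobinsonRodrigoSadowskiCUP2016, Thm 12.3, Lemma 6.11] -/
theorem step_Thm61_BKM_holds : Literature.Claims.NS.Betts2026.Step_Thm61_BKM := by
  intro ν hν u₀ hu₀ hint
  rw [← clayPeriodic_solvable_zero_iff_errata]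
  rcases clayPeriodic_solvable_or_gradientSupBlowup hν hu₀.smooth hu₀.divFree hu₀.periodic with
    hsol | ⟨Ts, hTs, u, p, hcl, hu0, hper, -, hens, -⟩
  · exact hsol
  exfalso
  apply hens
  -- the hypothesis on this slab solution
  have hfin : (∫⁻ t in Ioo 0 Ts, ⨆ x : EuclideanSpace ℝ (Fin 3), ‖fderiv ℝ (u t) x‖ₑ) < ⊤ :=
    hint Ts u p hTs ⟨hcl, hu0, hper⟩
  set I : ℝ := (∫⁻ t in Ioo 0 Ts, ⨆ x : EuclideanSpace ℝ (Fin 3), ‖fderiv ℝ (u t) x‖ₑ).toReal with hI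
  -- the descended torus solution
  obtain ⟨hT, hlift⟩ := torus_descend_of_periodic hcl hper
  set U : ℝ → UnitAddTorus (Fin 3) → EuclideanSpace ℝ (Fin 3) := fun t x => u t (Torus.repr x) with hU
  -- the gradient field on the torus is jointly smooth; its sup norm `G` is continuous in time
  have hD : Torus.IsSmoothSpaceTimeOn (Ico 0 Ts) (fun t x => Torus.fderiv (U t) x) :=
    hT.smooth_velocity.torusFderiv (uniqueDiffOn_Ico 0 Ts)
  set G : ℝ → ℝ := fun t => (eSupNorm (fun x => Torus.fderiv (U t) x)).toReal with hG
  have hGc : ContinuousOn G (Ico 0 Ts) := hD.continuousOn_toReal_eSupNorm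
  have hG0 : ∀ t, 0 ≤ G t := fun t => ENNReal.toReal_nonneg
  -- pointwise: `‖DU(t)(x)‖ ≤ G t` and `|ω|² ≤ 6 G²`
  have hGx : ∀ t ∈ Ico 0 Ts, ∀ x, ‖Torus.fderiv (U t) x‖ ≤ G t := fun t ht x =>
    Torus.norm_le_toReal_eSupNorm (hD.isSmooth_slice ht).continuous x
  set M : ℝ → ℝ := fun t => Real.sqrt 6 * G t with hM
  have hMc : ContinuousOn M (Ico 0 Ts) := continuousOn_const.mul hGc
  have hM0 : ∀ t ∈ Ico 0 Ts, 0 ≤ M t := fun t _ => mul_nonneg (Real.sqrt_nonneg _) (hG0 t)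
  have hω : ∀ t ∈ Ico 0 Ts, ∀ x, torusVorticitySqAt (U t) x ≤ M t ^ 2 := by
    intro t ht x
    have h1 := torusVorticitySqAt_le_two_mul_sum_norm_sq (U t) x
    have hsm : Torus.IsContDiff 1 (U t) :=
      (hT.smooth_velocity.isSmooth_slice ht).isContDiff (by exact_mod_cast le_top)
    have h2 : ∀ i, ‖Torus.partialDeriv i (U t) x‖ ≤ G t := by
      intro i
      rw [Torus.partialDeriv_eq_fderiv_apply hsm]
      refine (ContinuousLinearMap.le_opNorm _ _).trans ?_
      have hs : ‖(EuclideanSpace.single i (1 : ℝ) : EuclideanSpace ℝ (Fin 3))‖ = 1 := by simp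
      rw [hs, mul_one]
      exact hGx t ht x
    calc torusVorticitySqAt (U t) x ≤ 2 * ∑ i, ‖Torus.partialDeriv i (U t) x‖ ^ 2 := h1
      _ ≤ 2 * ∑ _i : Fin 3, G t ^ 2 := by gcongr with i; exact h2 i
      _ = M t ^ 2 := by
          rw [Finset.sum_const, Finset.card_univ, Fintype.card_fin, hM, mul_pow,
            Real.sq_sqrt (by norm_num)]
          simp; ring
  -- the primitive of `M` is bounded by `√6 · I`
  have hGle : ∀ s ∈ Ico 0 Ts, ENNReal.ofReal (G s) ≤ ⨆ y : EuclideanSpace ℝ (Fin 3), ‖fderiv ℝ (u s) y‖ₑ :=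
    fun s hs => (ENNReal.ofReal_toReal_le).trans (eSupNorm_torusFderiv_le (hlift s hs))
  have hprim : ∀ t ∈ Ico 0 Ts, ∫ s in (0:ℝ)..t, M s ≤ Real.sqrt 6 * I := by
    intro t ht
    have hsub : Icc 0 t ⊆ Ico 0 Ts := fun s hs => ⟨hs.1, lt_of_le_of_lt hs.2 ht.2⟩
    have hGi : IntervalIntegrable G volume 0 t :=
      (hGc.mono hsub).intervalIntegrable_of_Icc ht.1
    rw [intervalIntegral.integral_const_mul]
    refine mul_le_mul_of_nonneg_left ?_ (Real.sqrt_nonneg _)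
    rw [intervalIntegral.integral_of_le ht.1,
      integral_eq_lintegral_of_nonneg_ae (Eventually.of_forall fun s => hG0 s)
        ((hGc.mono (Ioc_subset_Icc_self.trans hsub)).aestronglyMeasurable measurableSet_Ioc)]
    refine ENNReal.toReal_mono hfin.ne ?_
    calc ∫⁻ s in Ioc 0 t, ENNReal.ofReal (G s)
        ≤ ∫⁻ s in Ioc 0 t, ⨆ y : EuclideanSpace ℝ (Fin 3), ‖fderiv ℝ (u s) y‖ₑ :=
          setLIntegral_mono' measurableSet_Ioc fun s hs => hGle s ⟨hs.1.le, lt_of_le_of_lt hs.2 ht.2⟩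
      _ ≤ ∫⁻ s in Ioo 0 Ts, ⨆ y : EuclideanSpace ℝ (Fin 3), ‖fderiv ℝ (u s) y‖ₑ :=
          lintegral_mono_set fun s hs => ⟨hs.1, lt_of_le_of_lt hs.2 ht.2⟩
  -- the enstrophy bound on `[0, Ts)`
  refine ⟨Torus.gradNormSq (U 0) * Real.exp (2 * (Real.sqrt 6 * I)), ?_⟩
  rintro _ ⟨t, ht, rfl⟩
  refine (Torus.gradNormSq_le_mul_exp_integral_vorticityBound (by simp) hν.le hT hMc hM0 hω ht).trans ?_
  exact mul_le_mul_of_nonneg_left (Real.exp_le_exp.2 (by linarith [hprim t ht]))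
    (Torus.gradNormSq_nonneg _)

end Summit.NavierStokesRegularity.NavierStokesRegularity.Theorems.Betts2026Salvage

end
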